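import Mathlib
import Summits.ResolutionOfSingularities.ResolutionOfSingularities.Theorems.SyzygyFlatteningDefs
import Summits.ResolutionOfSingularities.ResolutionOfSingularities.Theorems.SyzygyFlatteningHigherRankTerminationTowerStageBasic
import Summits.ResolutionOfSingularities.ResolutionOfSingularities.Theorems.SyzygyFlatteningHigherRankTerminationLocAt
import HarnessLib

/-!
# The canonical form of the syzygy-flattening chart, localised at a coarser centre

Crux `SyzygyFlattening.HigherRankTermination` (stmt-ResolutionOfSingularities-17045), line
`birth`, registered stub `stub_chart_canonical` of the lead's skeleton, PROVED here (statement
verbatim from the ledger registration).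

**Setting.** `k ⊆ O ≤ O₁` valuation rings of `K`, `B ⊆ O` a `k`-subalgebra of `K`. The chart
`chart O B = B[chartSet O B]` adjoins to `B` every Plücker ratio `det (ι' g') / det (ι' x')` of
every datum `(b', d', ε', r', ι')` (a finite free resolution of `B ⧸ J B` plus an embedding with
torsion cokernel of its `n`-th syzygy module into some `B^{r'}`) and every `O`-minimal tuple
`x'`. Fix ONE datum `(b, d, ε, r, ι)` with ONE `O`-minimal tuple `x`, write
`N := span_B {det (ι g) : g} ⊆ K` (the ideal of maximal minors, realised in `K`),
`dₓ := det (ι x)` and `R := {det (ι g) / dₓ : g}`; assume the INDEPENDENCE of the minor ideal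
(the content of the neighbouring stub `stub_normIdeal_indep`, here a hypothesis): for every
other datum, `span_B {det (ι' g')} = c • N` for some `c ∈ Kˣ`.

**Statement.** `locAt O₁ (chart O B) = locAt O₁ (B[R])`.

**Proof.** `⊇`: `R ⊆ chartSet O B` (the fixed datum is one of the data). `⊆`: it suffices that
`chartSet O B ⊆ locAt O₁ (B[R])` (then localise and use the idempotence `locAt_locAt`). A ratio
`y = det (ι' g') / det (ι' x')` of another datum has `det (ι' g') = c n`, `det (ι' x') = c n₁`
with `n, n₁ ∈ N`, so `y = n / n₁ = (n / dₓ) · (n₁ / dₓ)⁻¹`. Every `n / dₓ` (`n ∈ N`) lies in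
`B[R]` (span induction: `B[R]` is a `B`-module containing the generators `det (ι g) / dₓ`), in
particular in `O`; symmetrically, by the `O`-minimality of `x'`, every element of
`span_B {det (ι' g')} = c • N` divided by `det (ι' x') = c n₁` lies in `O`, whence
`dₓ / n₁ ∈ O`. So `u := n₁ / dₓ ∈ B[R]` is an `O`-unit, hence an `O₁`-unit, hence inverted in
`locAt O₁ (B[R])`, and `y = (n / dₓ) · u⁻¹ ∈ locAt O₁ (B[R])`. No resolution theory is used: the
datum is only unpacked and repacked (`ratio_mem_locAt_adjoin` is the heart, stated for arbitrary
"determinant" functions `D, D'`). [cite: NovacoskiSpivakovsky2014, Def. 2.11]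
-/

noncomputable section

-- single-problem summit: the doubled namespace component `ResolutionOfSingularities` is forced
set_option linter.dupNamespace false

namespace Summit.ResolutionOfSingularities.ResolutionOfSingularities.Theorems.SyzygyFlattening

variable {k K : Type} [Field k] [Field K] [Algebra k K]

/-! ## Span induction: dividing a `B`-span by a common denominator -/

/-- If every generator `D g` multiplied by `t` lies in a subring `T ⊇ B` of `K`, then so does
every element of the `B`-span of the `D g` multiplied by `t` (`T` is a `B`-submodule of `K`).
[folklore] -/
theorem span_mul_mem (B : Subalgebra k K) (T : Subring K) (hBT : ∀ b : K, b ∈ B → b ∈ T)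
    {G : Type} {D : G → K} {t : K} (hgen : ∀ g, D g * t ∈ T) {n : K}
    (hn : n ∈ Submodule.span ↥B (Set.range D)) : n * t ∈ T := by
  induction hn using Submodule.span_induction with
  | mem y hy =>
    obtain ⟨g, rfl⟩ := hy
    exact hgen g
  | zero =>
    rw [zero_mul]
    exact T.zero_mem
  | add y z _ _ hy hz =>
    rw [add_mul]
    exact T.add_mem hy hz
  | smul a y _ hy =>
    rw [Subalgebra.smul_def, smul_eq_mul, mul_assoc]
    exact T.mul_mem (hBT a a.2) hy

/-! ## The heart: a ratio of another datum lies in the localised canonical chart -/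

/-- **The heart of `stub_chart_canonical`.** Let `D : G → K`, `D' : G' → K` ("the maximal minors
of two data"), `x` `O`-minimal for `D` (`D x ≠ 0`, all `D g / D x ∈ O`), `x'` `O`-minimal for
`D'`, and `span_B (range D') = c • span_B (range D)`. Then every ratio `D' g' / D' x'` lies in
`locAt O₁ (B[{D g / D x : g}])` for every coarsening `O₁ ⊇ O`: with `D' g' = c n`,
`D' x' = c n₁` (`n, n₁ ∈ span_B (range D)`), `D' g' / D' x' = (n / D x) · (n₁ / D x)⁻¹`, where
`n / D x ∈ B[{D g / D x}]` and `n₁ / D x` is an `O`-unit of `B[{D g / D x}]` (its inverse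
`D x / n₁ = (c · D x) / D' x'` is in `O` by the minimality of `x'`). [cite: NovacoskiSpivakovsky2014, Def. 2.11] -/
theorem ratio_mem_locAt_adjoin (O O₁ : ValuationSubring K) (hO : O ≤ O₁) {B : Subalgebra k K}
    (hk : ∀ c : k, algebraMap k K c ∈ O) (hB : B.toSubring ≤ O.toSubring)
    {G G' : Type} {D : G → K} {D' : G' → K} {x : G} {x' : G'}
    (hx0 : D x ≠ 0) (hmin : ∀ g, D g * (D x)⁻¹ ∈ O)
    (hx0' : D' x' ≠ 0) (hmin' : ∀ g', D' g' * (D' x')⁻¹ ∈ O) {c : K}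
    (hspan : Submodule.span ↥B (Set.range D') =
      (Submodule.span ↥B (Set.range D)).map (LinearMap.mulLeft ↥B c))
    (g' : G') :
    D' g' * (D' x')⁻¹ ∈
      locAt O₁ (Algebra.adjoin k ((B : Set K) ∪ {y : K | ∃ g, y = D g * (D x)⁻¹})) := by
  set BR := Algebra.adjoin k ((B : Set K) ∪ {y : K | ∃ g, y = D g * (D x)⁻¹}) with hBR_def
  -- `B[R] ⊆ O ⊆ O₁` and `B ⊆ B[R]`
  have hBRO : BR.toSubring ≤ O.toSubring := by
    refine adjoin_toSubring_le_valuationSubring O hk ?_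
    rintro y (hy | ⟨g, rfl⟩)
    · exact hB (Subalgebra.mem_toSubring.mpr hy)
    · exact hmin g
  have hBRO₁ : BR.toSubring ≤ O₁.toSubring := fun y hy => hO (hBRO hy)
  have hB_BR : B ≤ BR := fun y hy => Algebra.subset_adjoin (Or.inl hy)
  -- (i) every element of `N = span (range D)` divided by `D x` lies in `B[R]`
  have hi : ∀ n ∈ Submodule.span ↥B (Set.range D), n * (D x)⁻¹ ∈ BR := fun n hn =>
    span_mul_mem B BR.toSubring (fun b hb => hB_BR hb)
      (fun g => Algebra.subset_adjoin (Or.inr ⟨g, rfl⟩)) hn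
  -- (ii) every element of `span (range D')` divided by `D' x'` lies in `O`
  have hii : ∀ m ∈ Submodule.span ↥B (Set.range D'), m * (D' x')⁻¹ ∈ O := fun m hm =>
    span_mul_mem B O.toSubring (fun b hb => hB (Subalgebra.mem_toSubring.mpr hb)) hmin' hm
  -- `D' g' = c * n`, `D' x' = c * n₁` with `n, n₁ ∈ N`
  have hDg' : D' g' ∈ (Submodule.span ↥B (Set.range D)).map (LinearMap.mulLeft ↥B c) := by
    rw [← hspan]
    exact Submodule.subset_span ⟨g', rfl⟩
  have hDx' : D' x' ∈ (Submodule.span ↥B (Set.range D)).map (LinearMap.mulLeft ↥B c) := by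
    rw [← hspan]
    exact Submodule.subset_span ⟨x', rfl⟩
  obtain ⟨n, hn, hcn⟩ := Submodule.mem_map.mp hDg'
  obtain ⟨n₁, hn₁, hcn₁⟩ := Submodule.mem_map.mp hDx'
  rw [LinearMap.mulLeft_apply] at hcn hcn₁
  have hc0 : c ≠ 0 := by
    rintro rfl
    rw [zero_mul] at hcn₁
    exact hx0' hcn₁.symm
  have hn₁0 : n₁ ≠ 0 := by
    rintro rfl
    rw [mul_zero] at hcn₁
    exact hx0' hcn₁.symm
  -- `c * D x ∈ span (range D')`, so `(c * D x) / D' x' ∈ O` by the minimality of `x'`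
  have hcDx : c * D x ∈ Submodule.span ↥B (Set.range D') := by
    rw [hspan]
    exact Submodule.mem_map.mpr ⟨D x, Submodule.subset_span ⟨x, rfl⟩, rfl⟩
  have h1 : (c * D x) * (D' x')⁻¹ ∈ O := hii _ hcDx
  -- `u := n₁ / D x ∈ B[R]` is an `O`-unit, hence an `O₁`-unit, hence inverted in `locAt O₁ B[R]`
  have hu : n₁ * (D x)⁻¹ ∈ BR := hi n₁ hn₁
  have huinv : (n₁ * (D x)⁻¹)⁻¹ ∈ O := by
    have : (n₁ * (D x)⁻¹)⁻¹ = (c * D x) * (D' x')⁻¹ := by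
      rw [← hcn₁]
      field_simp
    rw [this]
    exact h1
  have hu0 : n₁ * (D x)⁻¹ ≠ 0 := mul_ne_zero hn₁0 (inv_ne_zero hx0)
  have hval : O.valuation (n₁ * (D x)⁻¹) = 1 :=
    valuation_eq_one_of_inv_mem O (hBRO (Subalgebra.mem_toSubring.mpr hu)) huinv hu0
  have hval₁ : O₁.valuation (n₁ * (D x)⁻¹) = 1 := valuation_eq_one_of_le O O₁ hO hval
  have huinvL : (n₁ * (D x)⁻¹)⁻¹ ∈ locAt O₁ BR :=
    inv_mem_locAt O₁ BR hBRO₁ (self_le_locAt O₁ BR hu) hval₁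
  have hnL : n * (D x)⁻¹ ∈ locAt O₁ BR := self_le_locAt O₁ BR (hi n hn)
  have key : D' g' * (D' x')⁻¹ = (n * (D x)⁻¹) * (n₁ * (D x)⁻¹)⁻¹ := by
    rw [← hcn, ← hcn₁]
    field_simp
  rw [key]
  exact mul_mem hnL huinvL

/-! ## The registered stub -/

/-- **STUB `stub_chart_canonical` (canonical form of the chart, given independence).** For
`k ⊆ O ≤ O₁` and `B ⊆ O`, a datum `(b, d, ε, r, ι)` for `B ⧸ J B` at the route's index with an
`O`-minimal tuple `x`, and independence of the minor ideal of this datum against every other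
datum (up to `K^×`): the chart localised at the centre of `O₁` is
`B[det (ι g) / det (ι x) : g]` localised at the centre of `O₁`. `⊇`: the ratios
`det (ι g) / det (ι x)` are among the generators of the chart. `⊆`: every adjoined ratio of every
other datum lies in `locAt O₁ (B[det (ι g) / det (ι x)])` (`ratio_mem_locAt_adjoin`), and
`locAt O₁` is idempotent (`locAt_locAt`). [cite: NovacoskiSpivakovsky2014, Def. 2.11] -/
theorem stub_chart_canonical : ∀ (k K : Type) [Field k] [Field K] [Algebra k K]
    (O O₁ : ValuationSubring K) (B : Subalgebra k K), (∀ c : k, algebraMap k K c ∈ O) → O ≤ O₁ →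
      B.toSubring ≤ O.toSubring →
      ∀ (b : ℕ → ℕ) (d : (i : ℕ) → ((Fin (b (i + 1)) → ↥B) →ₗ[↥B] (Fin (b i) → ↥B)))
        (ε : (Fin (b 0) → ↥B) →ₗ[↥B] (↥B ⧸ singIdeal B)) (r : ℕ)
        (ι : ↥(LinearMap.range (d (syzygyIndex k K - 1))) →ₗ[↥B] (Fin r → ↥B))
        (x : Fin r → ↥(LinearMap.range (d (syzygyIndex k K - 1)))),
        Function.Surjective ε → Function.Exact (d 0) ε → (∀ i : ℕ, Function.Exact (d (i + 1)) (d i)) →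
        Function.Injective ι → (∀ z : Fin r → ↥B, ∃ a : ↥B, a ≠ 0 ∧ a • z ∈ LinearMap.range ι) →
        Matrix.det (Matrix.of fun i j => ((ι (x i) j : ↥B) : K)) ≠ 0 →
        (∀ g' : Fin r → ↥(LinearMap.range (d (syzygyIndex k K - 1))),
          Matrix.det (Matrix.of fun i j => ((ι (g' i) j : ↥B) : K)) *
            (Matrix.det (Matrix.of fun i j => ((ι (x i) j : ↥B) : K)))⁻¹ ∈ O) →
        (∀ (b' : ℕ → ℕ) (d' : (i : ℕ) → ((Fin (b' (i + 1)) → ↥B) →ₗ[↥B] (Fin (b' i) → ↥B)))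
        (ε' : (Fin (b' 0) → ↥B) →ₗ[↥B] (↥B ⧸ singIdeal B)) (r' : ℕ)
        (ι' : ↥(LinearMap.range (d' (syzygyIndex k K - 1))) →ₗ[↥B] (Fin r' → ↥B)),
          Function.Surjective ε' → Function.Exact (d' 0) ε' → (∀ i : ℕ, Function.Exact (d' (i + 1)) (d' i)) →
        Function.Injective ι' → (∀ z : Fin r' → ↥B, ∃ a : ↥B, a ≠ 0 ∧ a • z ∈ LinearMap.range ι') →
          ∃ c : K, c ≠ 0 ∧
            Submodule.span ↥B (Set.range fun g' : Fin r' → ↥(LinearMap.range (d' (syzygyIndex k K - 1))) =>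
                Matrix.det (Matrix.of fun i j => ((ι' (g' i) j : ↥B) : K))) =
              (Submodule.span ↥B (Set.range fun g : Fin r → ↥(LinearMap.range (d (syzygyIndex k K - 1))) =>
                Matrix.det (Matrix.of fun i j => ((ι (g i) j : ↥B) : K)))).map
                (LinearMap.mulLeft ↥B c)) →
        locAt O₁ (chart O B) =
          locAt O₁ (Algebra.adjoin k ((B : Set K) ∪
            {y : K | ∃ g : Fin r → ↥(LinearMap.range (d (syzygyIndex k K - 1))),
              y = Matrix.det (Matrix.of fun i j => ((ι (g i) j : ↥B) : K)) *
                (Matrix.det (Matrix.of fun i j => ((ι (x i) j : ↥B) : K)))⁻¹})) := by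
  intro k K _ _ _ O O₁ B hk hO hB b d ε r ι x hε h0 hs hι htors hx0 hmin hind
  rw [chart_def]
  apply le_antisymm
  · -- `⊆`: the chart lies in the localised canonical chart, then localise (idempotence)
    set BR := Algebra.adjoin k ((B : Set K) ∪
      {y : K | ∃ g : Fin r → ↥(LinearMap.range (d (syzygyIndex k K - 1))),
        y = Matrix.det (Matrix.of fun i j => ((ι (g i) j : ↥B) : K)) *
          (Matrix.det (Matrix.of fun i j => ((ι (x i) j : ↥B) : K)))⁻¹}) with hBR_def
    have hBRO : BR.toSubring ≤ O.toSubring := by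
      refine adjoin_toSubring_le_valuationSubring O hk ?_
      rintro y (hy | ⟨g, rfl⟩)
      · exact hB (Subalgebra.mem_toSubring.mpr hy)
      · exact hmin g
    have hBRO₁ : BR.toSubring ≤ O₁.toSubring := fun y hy => hO (hBRO hy)
    have hle : Algebra.adjoin k ((B : Set K) ∪ chartSet O B) ≤ locAt O₁ BR := by
      refine Algebra.adjoin_le ?_
      rintro y (hy | hy)
      · exact self_le_locAt O₁ BR (Algebra.subset_adjoin (Or.inl hy))
      · obtain ⟨b', d', ε', r', ι', hε', h0', hs', hι', htors', g', x', hx0', hmin', rfl⟩ := hy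
        obtain ⟨c, -, hspan⟩ := hind b' d' ε' r' ι' hε' h0' hs' hι' htors'
        exact ratio_mem_locAt_adjoin O O₁ hO hk hB
          (D := fun g : Fin r → ↥(LinearMap.range (d (syzygyIndex k K - 1))) =>
            Matrix.det (Matrix.of fun i j => ((ι (g i) j : ↥B) : K)))
          (D' := fun g' : Fin r' → ↥(LinearMap.range (d' (syzygyIndex k K - 1))) =>
            Matrix.det (Matrix.of fun i j => ((ι' (g' i) j : ↥B) : K)))
          (x := x) (x' := x') hx0 hmin hx0' hmin' hspan g'
    calc locAt O₁ (Algebra.adjoin k ((B : Set K) ∪ chartSet O B))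
        ≤ locAt O₁ (locAt O₁ BR) := locAt_mono O₁ hle
      _ = locAt O₁ BR := locAt_locAt O₁ BR hBRO₁
  · -- `⊇`: the ratios of the fixed datum are among the generators of the chart
    refine locAt_mono O₁ (Algebra.adjoin_mono ?_)
    rintro y (hy | ⟨g, rfl⟩)
    · exact Or.inl hy
    · exact Or.inr ⟨b, d, ε, r, ι, hε, h0, hs, hι, htors, g, x, hx0, hmin, rfl⟩

end Summit.ResolutionOfSingularities.ResolutionOfSingularities.Theorems.SyzygyFlattening

end
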